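import Summits.QuantumFields.YangMills.Theorems.BalabanUVNodesN22WindowSoftTwoPointAtRecord
import Summits.QuantumFields.YangMills.Theorems.BalabanUVNodesN22WindowedNE9OfCouplingHolo
import Summits.QuantumFields.YangMills.Theorems.BalabanUVNodesN27ReadOutAtU3OfKernels

/-!
# NODE N22 (NE9) — W1-19b's letters OF RECORD, K3⁷ v5 §2b's raw inputs `h9` ∕ `hdec` and the N22 ∕ (D4) pin faces AT THE RECORD, with the activity holomorphy
# READ FROM PRINT (`ClusterStep.AnalyticH`, [II] p. 15) — «(B)∘J32′ at the record»

Cell `pub-ymgap`, Track A (HUMAN RULING D-0062), WIDTH SEAT `dag-n22-w5` (g0) on node n22 = NE9, D-0154 (3a) second width wave; `--kind proof --supports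
stmt-QuantumFields-20544 --as helper` (K3⁷ `SpineGivenEndpointR13SepCoPH`, skeleton v5 941dddb108cbaacf), COUNT-NEUTRAL; THEOREMS ONLY (0 `def`, 0 `sorry`, standard
axioms).  The piece «(B)∘J32′ AT THE RECORD» handed on the cell bus (pub-ymgap INBOX l.29234, dag-n22-w2 g3; CLAIM-1 l.29287): a BY-NAME composition of
dag-n22-w2 g3's (B) `…N22WindowSoftTwoPointAtRecord` (K3⁷ v5 §2b's `h9`∕`hdec`∕pin face from ACTIVITY-LEVEL slots at the record) with dag-n22-c g12's J32′
`…N22WindowedNE9OfCouplingHolo` §1 (the chain rule at the activities: W1's PRINTED slot `AnalyticH` + a holomorphic reading ⟹ (A)'s activity-holomorphy hypothesis)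
and J31 `…N22W1YoungLipschitzOfCouplingHolo` (W1's two (2.38)-slots on the boxes from the young-coupling margin datum).  Nothing of (A)∕(B)∕J31∕J31b∕J32′ is
re-declared; every step is plain application.

WHAT.  In (B)'s record-level theorems the hypothesis `hHhol` («every activity `z ↦ H(Z; histPrefix g k; Φ K k X z)`, `Z ⊆ X`, is holomorphic on `U K k X`») is DISCHARGED by
J32′ §1 `differentiableOn_H_comp_of_analyticH` from W1's PRINTED slot `AnalyticH ((S K) k) (Wk K k) (sp K k)` at every tower∕level ([II] p. 15 «the activities in (2.13) … are
analytic functions of (𝐔,𝐉), on the space U^c_{k+1}(X, α₀, α₁)») and holomorphic readings `DifferentiableOn ℂ (Φ K k X) (U K k X)` (NODE A: [I] p. 264).  Outputs, at the objects of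
record `objectsOfRecord₁₃ F N θ ℓ` (configuration algebra `MatA N` under `Matrix.Norms.L2Operator`; its ℝ-structure Mathlib's `NormedAlgebra.complexToReal`):
* §1 ★ `windowedNE9OfRecord₁₃_of_printedSlots` ∕ ★ `windowedDecayOfRecord₁₃_of_printedSlots` — W1-19b's two letters OF RECORD (the currency of dag-n27-w1's
  `keyedRatesHolderD4_rrOfRecord_of_pins_of_letters`, `Thm/BalabanUVNodesK3V5Defs`);
* §2 ★★★ `ne9_EA_objectsOfRecord₁₃_of_printedSlots` — LITERALLY the `h9 : NE9 ((objectsOfRecord₁₃ F 2 θ ℓ).EA 0) (Window θ.γ) ℓ.κ ℓ.moduli` of K3⁷ v5 §2b `n22At_rrOfRecord_of_pinned`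
  (at `N := 2`) — and ★★★ `kernelDecayOfRecord₁₃_of_printedSlots` — the `hdec : KernelDecayOfRecord₁₃ F N θ μ ν κ′` of `readOutAt_rrOfRecord_of_pinned`, any `κ′ ≤ δ₁`;
* §3 the PIN FACES for EVERY run length `k` at a Stage-13 rate reading `𝔯` whose node-U3 objects at the tuple ARE the kernel objects of record (`hpin`): ★★★
  `n22At_rateCarriers_of_kernels_pin_of_printedSlots : N22At (rateCarriersOfRecord₁₃CoPH 𝔯 F θ hP g₀ os k).u3` (dag-n22-w3's `n22At_rateCarriers_of_kernels_pin_of_ne9`) and ★★★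
  `readOutAt_rateCarriers_of_kernels_pin_of_printedSlots : ReadOutAt (datumOfRecord₁₃CoPH F N θ hP) (rateCarriersOfRecord₁₃CoPH 𝔯 F θ hP g₀ os k).u3` (dag-n27-w1's
  `readOutAt_objectsOfRecord₁₃_coPH`, p591653: (D4) at the pinned objects = print's (5.10) clause of record + the letter rows `0 < ℓ.κ`, `β′₅.₁₀(4,1,ℓ.κ) ≤ ℓ.cr`);
* §4 A5∕A6 rider `analyticH_termlessStep`: the termless MODEL step carries `AnalyticH` on any tables (with J31 `coordHolo_termlessStep` and dag-n22-w2 g3's `…AtSlotsInhabited`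
  the non-record hypotheses are jointly inhabited at the EMPTY towers — a DEGENERATE model witness, declared; the record's law `Localizes17OfRecord₁₃`, `PolLimitsExistOfRecord₁₃`,
  `θ` and the reading OF RECORD are LOCATED hypotheses, NOT inhabited here).
DISPLAYED INPUTS after this file: the towers∕reading with W1-20's law `Localizes17OfRecord₁₃`, W1's THREE slots `Bound238` ∕ `YoungLipschitz` ∕ `AnalyticH` on prefix sets
containing the cut histories of the window (N10's Lemmas 1–3 ∕ NODE A; the differenced slot NOT PRINTED), the holomorphic complexified readings `Φ` with chart∕space clauses, the
site weights with the minimizer tails ([I] p. 282), Road 1's numerals, the (1.21) existence `PolLimitsExistOfRecord₁₃` (dag-n22-w3 g3's road), and a letter block `ℓ`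
DOMINATING the engine's constants (`ℓ.κ ≤ δ₁`, `C_9·Λ ≤ ℓ.moduli`; dag-n22-w1 g2's `letterModuli_le_iff_radii` reads the rows).  The companion `…N22AtRecordOfCouplingHoloSlots`
(this seat) reads, in addition, W1's two (2.38)-slots from J31's young-coupling margin datum.

HONEST FRAMING (binding).  Count-neutral COMPOSITION of landed theorems by name; NO estimate of Bałaban's is proved or asserted; every displayed input above is a
HYPOTHESIS with its owner (N10 ∕ NODE A ∕ N09 ∕ def-W1 letters ∕ dag-n22-w3's (1.21) road); nothing of the record is constructed or claimed to meet them; N22 is NOT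
discharged (typed 28∕28 · discharged 5∕27 UNCHANGED); K3⁷ OPEN and NOT claimed; NE9 is NOT IN PRINT for d = 4; no count claim (the chair's single count line is the only
count); no summit statement is proved by this seat; one finite 𝕋⁴ programme at fixed ε — R4 closes the CONDITIONAL rung `BalabanLadder.UV` only; NOTHING about the
continuum limit, ℝ⁴, infinite volume, OS axioms, a mass gap or the Clay problem is proved or claimed by any of this.  References (TYPES only, no cite tags on the
Summit side): [I] = Bałaban, CMP 109 (1987) (1.7) p. 261, §1 p. 263, (1.18) p. 263, (1.20)–(1.21) p. 264, p. 282, (5.10) p. 293; [II] = CMP 116 (1988) (2.13)–(2.14)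
pp. 14–15, p. 15 (analyticity statement), (2.38) p. 20, (2.39)–(2.41) p. 21.
-/

noncomputable section

open Filter Topology Metric Set
open scoped BigOperators

namespace YMDAG.N22.AtRecordOfPrintedSlots

open Literature.MathematicalPhysics.QuantumFieldTheory.Balaban1983to89
open Literature.MathematicalPhysics.QuantumFieldTheory.Balaban1983to89.T4Continuum (T4Family ULoop)
open Literature.MathematicalPhysics.QuantumFieldTheory.Balaban1983to89.T4OutputRate (Window NE9)
open Literature.MathematicalPhysics.QuantumFieldTheory.Balaban1983to89.Node00 (Stage13Params Stage13HParams U3Letters₁₁ MatA datumOfRecord₁₃CoPH)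
open Literature.MathematicalPhysics.QuantumFieldTheory.Balaban1983to89.Node00.Sect2 (domCount domSys CPair)
open Literature.MathematicalPhysics.QuantumFieldTheory.Balaban1983to89.Node00.LocalizedSum17 (ReadingMaps Localizes17OfRecord₁₃)
open Literature.MathematicalPhysics.QuantumFieldTheory.Balaban1983to89.Node00.W1 (ClusterTower ClusterStep)
open Literature.MathematicalPhysics.QuantumFieldTheory.Balaban1983to89.Node00.U3OfKernels (histPrefix objectsOfRecord₁₃ KernelDecayOfRecord₁₃)
open Literature.MathematicalPhysics.QuantumFieldTheory.Balaban1983to89.Node00.U3KernelLetters (WindowedNE9OfRecord₁₃ WindowedDecayOfRecord₁₃ PolLimitsExistOfRecord₁₃)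
open Literature.MathematicalPhysics.QuantumFieldTheory.Balaban1983to89.B12Decay510 (delta1)
open Literature.MathematicalPhysics.QuantumFieldTheory.Balaban1983to89.B12Decay510Window (K₁)
open Literature.MathematicalPhysics.QuantumFieldTheory.Balaban1983to89.B12Decay510Torus (distCT nearT)
open Literature.MathematicalPhysics.QuantumFieldTheory.Balaban1983to89.B12TreeDecay (K₀ kappa₀)
open Literature.MathematicalPhysics.QuantumFieldTheory.Balaban1983to89.TreeLengthTorus (TPt)
open Literature.MathematicalPhysics.QuantumFieldTheory.Balaban1983to89.B12Sec2to5 (betaPrime510)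
open YMDAG.UVSplit (N22At ReadOutAt u3OfRecord₁₃ RateReading₁₃CoPH rateCarriersOfRecord₁₃CoPH)
open YMDAG.N22.AtKernels (n22At_rateCarriers_of_kernels_pin_of_ne9)
open YMDAG.N22.WindowSoftTwoPoint (windowedNE9OfRecord₁₃_of_activitySlots windowedDecayOfRecord₁₃_of_activitySlots ne9_EA_objectsOfRecord₁₃_of_activitySlots
  kernelDecayOfRecord₁₃_of_activitySlots)
open Summit.QuantumFields.YangMills.BalabanUVNodes.N27ReadOutAtU3OfKernels (readOutAt_objectsOfRecord₁₃_coPH)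
open YMDAG.N22.WindowedOfCouplingHolo (differentiableOn_H_comp_of_analyticH)

open scoped Matrix.Norms.L2Operator

variable (F : T4Family) (N : ℕ) [NeZero N]

/-! ## §1 W1-19b's two letters OF RECORD with the activity holomorphy READ FROM PRINT (`AnalyticH`, [II] p. 15) -/

open Classical in
/-- ★ **W1-19b's LETTER OF RECORD FROM W1's THREE SLOTS.**  Towers `S K : ClusterTower (F.P K) (MatA N) M` (`M = L^{m′}`) and reading maps `emb` with W1-20's law
`Localizes17OfRecord₁₃ F N θ S emb`; at every tower and level W1's `Bound238`, `YoungLipschitz` (moduli `Λ (k+1) ·`) and PRINTED `AnalyticH` on prefix sets `Wk K k`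
containing the cut histories of the window `]0, θ.γ]^ℕ`; Road 1's numerals ONCE; complexified probe readings `Φ K k X` of the record's β-chart, HOLOMORPHIC on open
`U K k X ⊇ ball 0 r`, extending `emb K k ∘ exp θ.ρ8` and mapping `U K k X` into the spaces; site weights with the minimizer tails ⟹ `WindowedNE9OfRecord₁₃ F N θ δ₁ (C_9·Λ)`
— dag-n22-w2's `windowedNE9OfRecord₁₃_of_activitySlots` with `hHhol` discharged by dag-n22-c's chain rule `differentiableOn_H_comp_of_analyticH`.  LOCATED (hypothesis form). -/
theorem windowedNE9OfRecord₁₃_of_printedSlots (θ : Stage13Params F N) (m' : ℕ) (M : ℕ) [NeZero M] (hM : M = F.L ^ m')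
    (S : (K : ℕ) → ClusterTower (F.P K) (MatA N) M) (emb : ReadingMaps F (MatA N) (MatA N)) (hloc : Localizes17OfRecord₁₃ F N θ S emb)
    (Wk : (K k : ℕ) → Set (Fin (k + 1) → ℝ)) (hWk : ∀ g ∈ Window θ.γ, ∀ K k, histPrefix g k ∈ Wk K k)
    (sp : (K k : ℕ) → (domSys (F.P K) M (k + 1)).Dom → Set (CPair (F.P K) (MatA N)))
    {A R r₁ κ δ₀ B₃ r : ℝ} (Λ : ℕ → ℕ → ℝ)
    (hA : 0 < A) (hr₁ : 0 ≤ r₁) (hκ : κ ≤ r₁) (hκ₀ : kappa₀ (4 * 2 ^ 4) (2 * 4) ≤ κ / 2) (hrate : r₁ + 2 * (64 * Real.log 162) + 2 ≤ R)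
    (hsmall : 2 * A * Real.exp (5 * r₁ + 1) * K₀ 64 8 * 9 * 64 ≤ 1) (hΛ : ∀ k i, 0 ≤ Λ k i) (hδ₀ : 0 < δ₀) (hB₃ : 0 ≤ B₃) (hr : 0 < r)
    (h238 : ∀ K k, ((S K) k).Bound238 (Wk K k) (sp K k) A R)
    (hYL : ∀ K k, ((S K) k).YoungLipschitz (Wk K k) (sp K k) (fun i : Fin (k + 1) => Λ (k + 1) i) R)
    (hAn : ∀ K k, ((S K) k).AnalyticH (Wk K k) (sp K k))
    (Ec : ℕ → ℕ → Type*) [∀ K k, NormedAddCommGroup (Ec K k)] [∀ K k, NormedSpace ℂ (Ec K k)]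
    (ι : letI := θ.instVβ₁; letI := θ.instVβ₂
      (K k : ℕ) → (domSys (F.P K) M (k + 1)).Dom → ((Fin (F.P K).d → Site (F.P K) (k + 1) → θ.Vβ) →L[ℝ] Ec K k))
    (Φ : (K k : ℕ) → (domSys (F.P K) M (k + 1)).Dom → Ec K k → CPair (F.P K) (MatA N))
    (U : (K k : ℕ) → (domSys (F.P K) M (k + 1)).Dom → Set (Ec K k)) (hU : ∀ K k X, IsOpen (U K k X)) (hrU : ∀ K k X, ball (0 : Ec K k) r ⊆ U K k X)
    (hΦhol : ∀ (K k : ℕ) (X : (domSys (F.P K) M (k + 1)).Dom), DifferentiableOn ℂ (Φ K k X) (U K k X))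
    (hΦemb : letI := θ.instVβ₁; letI := θ.instVβ₂
      ∀ (K k : ℕ) (X : (domSys (F.P K) M (k + 1)).Dom) (B : Fin (F.P K).d → Site (F.P K) (k + 1) → θ.Vβ),
        Φ K k X (ι K k X B) = emb K k (fun l t => NormedSpace.exp (θ.ρ8 (B l t))))
    (hΦsp : ∀ (K k : ℕ) (X : (domSys (F.P K) M (k + 1)).Dom), ∀ z ∈ U K k X, ∀ Z : (domSys (F.P K) M (k + 1)).Dom, Z.1 ⊆ X.1 → Φ K k X z ∈ sp K k Z)
    (w : (K k : ℕ) → (domSys (F.P K) M (k + 1)).Dom → Site (F.P K) (k + 1) → ℝ) (hw₀ : ∀ K k X t, 0 ≤ w K k X t)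
    (hw : letI := θ.instVβ₁; letI := θ.instVβ₂; letI := θ.instιβ
      ∀ (K k : ℕ) (X : (domSys (F.P K) M (k + 1)).Dom) (l : Fin (F.P K).d) (t : Site (F.P K) (k + 1)) (c : θ.ιβ),
        ‖ι K k X (Pi.single l (Pi.single t (θ.bV c)))‖ ≤ w K k X t)
    (htail : ∀ (K k : ℕ) (X : (domSys (F.P K) M (k + 1)).Dom) (t : Site (F.P K) (k + 1)),
      let e : Site (F.P K) (k + 1) → TPt 4 (domCount (F.P K) M (k + 1) * M) := fun x i => (ZMod.cast (x i) : ZMod (domCount (F.P K) M (k + 1) * M))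
      w K k X t ≤ B₃ * Real.exp (-δ₀ * distCT (domCount (F.P K) M (k + 1)) M (e t) (nearT (M := M) (e t) X))) :
    WindowedNE9OfRecord₁₃ F N θ (delta1 δ₀ κ ((M : ℝ) * 4))
      (fun k i => (16 * (8 * (Real.exp 1 * 9 * 64 * K₀ 64 8 ^ 2)) * B₃ ^ 2 / r ^ 2) *
        Real.exp (delta1 δ₀ κ ((M : ℝ) * 4) * ((M : ℝ) * 4) * 3) * K₀ (4 * 2 ^ 4) (2 * 4) * K₁ 4 (δ₀ / 2) * Λ k i) :=
  windowedNE9OfRecord₁₃_of_activitySlots F N θ m' M hM S emb hloc Wk hWk sp Λ hA hr₁ hκ hκ₀ hrate hsmall hΛ hδ₀ hB₃ hr h238 hYL Ec ι Φ U hU hrU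
    (fun g hg K k X => differentiableOn_H_comp_of_analyticH ((S K) k) (Wk K k) (sp K k) (hAn K k) (hWk g hg K k) (Φ K k X) (hΦhol K k X) X
      (hΦsp K k X))
    hΦemb hΦsp w hw₀ hw htail

open Classical in
/-- ★ **W1-19b's VALUE LETTER OF RECORD FROM `Bound238` + PRINTED `AnalyticH` + HOLOMORPHIC READINGS + TAILS**: towers∕reading with `Localizes17OfRecord₁₃ F N θ S emb`, `Bound238` at
every tower and level (`0 ≤ A`, single smallness), PRINTED `AnalyticH`, holomorphic readings of the record's β-chart with chart∕space clauses, site weights with the minimizer tails ⟹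
`WindowedDecayOfRecord₁₃ F N θ μ ν δ₁` — dag-n22-w2's `windowedDecayOfRecord₁₃_of_activitySlots` with `hHhol` discharged by dag-n22-c's `differentiableOn_H_comp_of_analyticH`.
LOCATED (hypothesis form). -/
theorem windowedDecayOfRecord₁₃_of_printedSlots (θ : Stage13Params F N) (m' : ℕ) (M : ℕ) [NeZero M] (hM : M = F.L ^ m')
    (S : (K : ℕ) → ClusterTower (F.P K) (MatA N) M) (emb : ReadingMaps F (MatA N) (MatA N)) (hloc : Localizes17OfRecord₁₃ F N θ S emb)
    (Wk : (K k : ℕ) → Set (Fin (k + 1) → ℝ)) (hWk : ∀ g ∈ Window θ.γ, ∀ K k, histPrefix g k ∈ Wk K k)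
    (sp : (K k : ℕ) → (domSys (F.P K) M (k + 1)).Dom → Set (CPair (F.P K) (MatA N)))
    {A R r₁ κ δ₀ B₃ r : ℝ}
    (hA : 0 ≤ A) (hr₁ : 0 ≤ r₁) (hκ : κ ≤ r₁) (hκ₀ : kappa₀ (4 * 2 ^ 4) (2 * 4) ≤ κ / 2) (hrate : r₁ + 2 * (64 * Real.log 162) + 2 ≤ R)
    (hsmall : A * Real.exp (5 * r₁ + 1) * K₀ 64 8 * 9 * 64 ≤ 1) (hδ₀ : 0 < δ₀) (hB₃ : 0 ≤ B₃) (hr : 0 < r)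
    (h238 : ∀ K k, ((S K) k).Bound238 (Wk K k) (sp K k) A R)
    (hAn : ∀ K k, ((S K) k).AnalyticH (Wk K k) (sp K k))
    (Ec : ℕ → ℕ → Type*) [∀ K k, NormedAddCommGroup (Ec K k)] [∀ K k, NormedSpace ℂ (Ec K k)]
    (ι : letI := θ.instVβ₁; letI := θ.instVβ₂
      (K k : ℕ) → (domSys (F.P K) M (k + 1)).Dom → ((Fin (F.P K).d → Site (F.P K) (k + 1) → θ.Vβ) →L[ℝ] Ec K k))
    (Φ : (K k : ℕ) → (domSys (F.P K) M (k + 1)).Dom → Ec K k → CPair (F.P K) (MatA N))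
    (U : (K k : ℕ) → (domSys (F.P K) M (k + 1)).Dom → Set (Ec K k)) (hU : ∀ K k X, IsOpen (U K k X)) (hrU : ∀ K k X, ball (0 : Ec K k) r ⊆ U K k X)
    (hΦhol : ∀ (K k : ℕ) (X : (domSys (F.P K) M (k + 1)).Dom), DifferentiableOn ℂ (Φ K k X) (U K k X))
    (hΦemb : letI := θ.instVβ₁; letI := θ.instVβ₂
      ∀ (K k : ℕ) (X : (domSys (F.P K) M (k + 1)).Dom) (B : Fin (F.P K).d → Site (F.P K) (k + 1) → θ.Vβ),
        Φ K k X (ι K k X B) = emb K k (fun l t => NormedSpace.exp (θ.ρ8 (B l t))))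
    (hΦsp : ∀ (K k : ℕ) (X : (domSys (F.P K) M (k + 1)).Dom), ∀ z ∈ U K k X, ∀ Z : (domSys (F.P K) M (k + 1)).Dom, Z.1 ⊆ X.1 → Φ K k X z ∈ sp K k Z)
    (w : (K k : ℕ) → (domSys (F.P K) M (k + 1)).Dom → Site (F.P K) (k + 1) → ℝ) (hw₀ : ∀ K k X t, 0 ≤ w K k X t)
    (hw : letI := θ.instVβ₁; letI := θ.instVβ₂; letI := θ.instιβ
      ∀ (K k : ℕ) (X : (domSys (F.P K) M (k + 1)).Dom) (l : Fin (F.P K).d) (t : Site (F.P K) (k + 1)) (c : θ.ιβ),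
        ‖ι K k X (Pi.single l (Pi.single t (θ.bV c)))‖ ≤ w K k X t)
    (htail : ∀ (K k : ℕ) (X : (domSys (F.P K) M (k + 1)).Dom) (t : Site (F.P K) (k + 1)),
      let e : Site (F.P K) (k + 1) → TPt 4 (domCount (F.P K) M (k + 1) * M) := fun x i => (ZMod.cast (x i) : ZMod (domCount (F.P K) M (k + 1) * M))
      w K k X t ≤ B₃ * Real.exp (-δ₀ * distCT (domCount (F.P K) M (k + 1)) M (e t) (nearT (M := M) (e t) X))) (μ ν : Fin 4) :
    WindowedDecayOfRecord₁₃ F N θ μ ν (delta1 δ₀ κ ((M : ℝ) * 4)) :=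
  windowedDecayOfRecord₁₃_of_activitySlots F N θ m' M hM S emb hloc Wk hWk sp hA hr₁ hκ hκ₀ hrate hsmall hδ₀ hB₃ hr h238 Ec ι Φ U hU hrU
    (fun g hg K k X => differentiableOn_H_comp_of_analyticH ((S K) k) (Wk K k) (sp K k) (hAn K k) (hWk g hg K k) (Φ K k X) (hΦhol K k X) X
      (hΦsp K k X))
    hΦemb hΦsp w hw₀ hw htail μ ν

/-! ## §2 K3⁷ v5 §2b's raw inputs at the pinned objects: `h9` (kernel-currency NE9 of the functional of record) and `hdec` (`KernelDecayOfRecord₁₃`) -/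

open Classical in
/-- ★★★ **THE `h9` OF K3⁷ v5 §2b FROM W1's THREE SLOTS (PRINTED analyticity) + THE (1.21) EXISTENCE OF RECORD.**  For a letter block `ℓ` with its signs DOMINATING
the engine's constants (`ℓ.κ ≤ δ₁`, `C_9·Λ k i ≤ ℓ.moduli k i`): towers∕reading with `Localizes17OfRecord₁₃ F N θ S emb`, W1's `Bound238` ∕ `YoungLipschitz` ∕ PRINTED
`AnalyticH` at every tower∕level, holomorphic readings `Φ` with chart∕space clauses, site weights with tails, Road 1's numerals and `PolLimitsExistOfRecord₁₃ F N θ` ⟹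
`NE9 ((objectsOfRecord₁₃ F N θ ℓ).EA 0) (Window θ.γ) ℓ.κ ℓ.moduli` — dag-n22-w2's `ne9_EA_objectsOfRecord₁₃_of_activitySlots` ∘ dag-n22-c's `differentiableOn_H_comp_of_analyticH`.
LOCATED (hypothesis form); N22 NOT discharged. -/
theorem ne9_EA_objectsOfRecord₁₃_of_printedSlots (θ : Stage13Params F N) (ℓ : U3Letters₁₁) (hs : ℓ.Signs) (hlim : PolLimitsExistOfRecord₁₃ F N θ)
    (m' : ℕ) (M : ℕ) [NeZero M] (hM : M = F.L ^ m')
    (S : (K : ℕ) → ClusterTower (F.P K) (MatA N) M) (emb : ReadingMaps F (MatA N) (MatA N)) (hloc : Localizes17OfRecord₁₃ F N θ S emb)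
    (Wk : (K k : ℕ) → Set (Fin (k + 1) → ℝ)) (hWk : ∀ g ∈ Window θ.γ, ∀ K k, histPrefix g k ∈ Wk K k)
    (sp : (K k : ℕ) → (domSys (F.P K) M (k + 1)).Dom → Set (CPair (F.P K) (MatA N)))
    {A R r₁ κ δ₀ B₃ r : ℝ} (Λ : ℕ → ℕ → ℝ)
    (hA : 0 < A) (hr₁ : 0 ≤ r₁) (hκ : κ ≤ r₁) (hκ₀ : kappa₀ (4 * 2 ^ 4) (2 * 4) ≤ κ / 2) (hrate : r₁ + 2 * (64 * Real.log 162) + 2 ≤ R)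
    (hsmall : 2 * A * Real.exp (5 * r₁ + 1) * K₀ 64 8 * 9 * 64 ≤ 1) (hΛ : ∀ k i, 0 ≤ Λ k i) (hδ₀ : 0 < δ₀) (hB₃ : 0 ≤ B₃) (hr : 0 < r)
    (h238 : ∀ K k, ((S K) k).Bound238 (Wk K k) (sp K k) A R)
    (hYL : ∀ K k, ((S K) k).YoungLipschitz (Wk K k) (sp K k) (fun i : Fin (k + 1) => Λ (k + 1) i) R)
    (hAn : ∀ K k, ((S K) k).AnalyticH (Wk K k) (sp K k))
    (Ec : ℕ → ℕ → Type*) [∀ K k, NormedAddCommGroup (Ec K k)] [∀ K k, NormedSpace ℂ (Ec K k)]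
    (ι : letI := θ.instVβ₁; letI := θ.instVβ₂
      (K k : ℕ) → (domSys (F.P K) M (k + 1)).Dom → ((Fin (F.P K).d → Site (F.P K) (k + 1) → θ.Vβ) →L[ℝ] Ec K k))
    (Φ : (K k : ℕ) → (domSys (F.P K) M (k + 1)).Dom → Ec K k → CPair (F.P K) (MatA N))
    (U : (K k : ℕ) → (domSys (F.P K) M (k + 1)).Dom → Set (Ec K k)) (hU : ∀ K k X, IsOpen (U K k X)) (hrU : ∀ K k X, ball (0 : Ec K k) r ⊆ U K k X)
    (hΦhol : ∀ (K k : ℕ) (X : (domSys (F.P K) M (k + 1)).Dom), DifferentiableOn ℂ (Φ K k X) (U K k X))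
    (hΦemb : letI := θ.instVβ₁; letI := θ.instVβ₂
      ∀ (K k : ℕ) (X : (domSys (F.P K) M (k + 1)).Dom) (B : Fin (F.P K).d → Site (F.P K) (k + 1) → θ.Vβ),
        Φ K k X (ι K k X B) = emb K k (fun l t => NormedSpace.exp (θ.ρ8 (B l t))))
    (hΦsp : ∀ (K k : ℕ) (X : (domSys (F.P K) M (k + 1)).Dom), ∀ z ∈ U K k X, ∀ Z : (domSys (F.P K) M (k + 1)).Dom, Z.1 ⊆ X.1 → Φ K k X z ∈ sp K k Z)
    (w : (K k : ℕ) → (domSys (F.P K) M (k + 1)).Dom → Site (F.P K) (k + 1) → ℝ) (hw₀ : ∀ K k X t, 0 ≤ w K k X t)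
    (hw : letI := θ.instVβ₁; letI := θ.instVβ₂; letI := θ.instιβ
      ∀ (K k : ℕ) (X : (domSys (F.P K) M (k + 1)).Dom) (l : Fin (F.P K).d) (t : Site (F.P K) (k + 1)) (c : θ.ιβ),
        ‖ι K k X (Pi.single l (Pi.single t (θ.bV c)))‖ ≤ w K k X t)
    (htail : ∀ (K k : ℕ) (X : (domSys (F.P K) M (k + 1)).Dom) (t : Site (F.P K) (k + 1)),
      let e : Site (F.P K) (k + 1) → TPt 4 (domCount (F.P K) M (k + 1) * M) := fun x i => (ZMod.cast (x i) : ZMod (domCount (F.P K) M (k + 1) * M))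
      w K k X t ≤ B₃ * Real.exp (-δ₀ * distCT (domCount (F.P K) M (k + 1)) M (e t) (nearT (M := M) (e t) X)))
    (hℓκ : ℓ.κ ≤ delta1 δ₀ κ ((M : ℝ) * 4))
    (hdom : ∀ k i, (16 * (8 * (Real.exp 1 * 9 * 64 * K₀ 64 8 ^ 2)) * B₃ ^ 2 / r ^ 2) *
        Real.exp (delta1 δ₀ κ ((M : ℝ) * 4) * ((M : ℝ) * 4) * 3) * K₀ (4 * 2 ^ 4) (2 * 4) * K₁ 4 (δ₀ / 2) * Λ k i ≤ ℓ.moduli k i) :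
    NE9 ((objectsOfRecord₁₃ F N θ ℓ).EA 0) (Window θ.γ) ℓ.κ ℓ.moduli :=
  ne9_EA_objectsOfRecord₁₃_of_activitySlots F N θ ℓ hs hlim m' M hM S emb hloc Wk hWk sp Λ hA hr₁ hκ hκ₀ hrate hsmall hΛ hδ₀ hB₃ hr h238 hYL Ec ι Φ U hU hrU
    (fun g hg K k X => differentiableOn_H_comp_of_analyticH ((S K) k) (Wk K k) (sp K k) (hAn K k) (hWk g hg K k) (Φ K k X) (hΦhol K k X) X
      (hΦsp K k X))
    hΦemb hΦsp w hw₀ hw htail hℓκ hdom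

open Classical in
/-- ★★★ **THE `hdec` OF K3⁷ v5 §2b — (5.10) DECAY OF RECORD `KernelDecayOfRecord₁₃ F N θ μ ν κ′` AT ANY RATE `κ′ ≤ δ₁` — FROM `Bound238` + PRINTED `AnalyticH` + HOLOMORPHIC
READINGS + TAILS + (1.21) EXISTENCE** — dag-n22-w2's `kernelDecayOfRecord₁₃_of_activitySlots` ∘ dag-n22-c's `differentiableOn_H_comp_of_analyticH`.  LOCATED (hypothesis
form); (D4) NOT discharged. -/
theorem kernelDecayOfRecord₁₃_of_printedSlots (θ : Stage13Params F N) (hlim : PolLimitsExistOfRecord₁₃ F N θ) (m' : ℕ) (M : ℕ) [NeZero M] (hM : M = F.L ^ m')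
    (S : (K : ℕ) → ClusterTower (F.P K) (MatA N) M) (emb : ReadingMaps F (MatA N) (MatA N)) (hloc : Localizes17OfRecord₁₃ F N θ S emb)
    (Wk : (K k : ℕ) → Set (Fin (k + 1) → ℝ)) (hWk : ∀ g ∈ Window θ.γ, ∀ K k, histPrefix g k ∈ Wk K k)
    (sp : (K k : ℕ) → (domSys (F.P K) M (k + 1)).Dom → Set (CPair (F.P K) (MatA N)))
    {A R r₁ κ δ₀ B₃ r κ' : ℝ}
    (hA : 0 ≤ A) (hr₁ : 0 ≤ r₁) (hκ : κ ≤ r₁) (hκ₀ : kappa₀ (4 * 2 ^ 4) (2 * 4) ≤ κ / 2) (hrate : r₁ + 2 * (64 * Real.log 162) + 2 ≤ R)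
    (hsmall : A * Real.exp (5 * r₁ + 1) * K₀ 64 8 * 9 * 64 ≤ 1) (hδ₀ : 0 < δ₀) (hB₃ : 0 ≤ B₃) (hr : 0 < r)
    (h238 : ∀ K k, ((S K) k).Bound238 (Wk K k) (sp K k) A R)
    (hAn : ∀ K k, ((S K) k).AnalyticH (Wk K k) (sp K k))
    (Ec : ℕ → ℕ → Type*) [∀ K k, NormedAddCommGroup (Ec K k)] [∀ K k, NormedSpace ℂ (Ec K k)]
    (ι : letI := θ.instVβ₁; letI := θ.instVβ₂
      (K k : ℕ) → (domSys (F.P K) M (k + 1)).Dom → ((Fin (F.P K).d → Site (F.P K) (k + 1) → θ.Vβ) →L[ℝ] Ec K k))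
    (Φ : (K k : ℕ) → (domSys (F.P K) M (k + 1)).Dom → Ec K k → CPair (F.P K) (MatA N))
    (U : (K k : ℕ) → (domSys (F.P K) M (k + 1)).Dom → Set (Ec K k)) (hU : ∀ K k X, IsOpen (U K k X)) (hrU : ∀ K k X, ball (0 : Ec K k) r ⊆ U K k X)
    (hΦhol : ∀ (K k : ℕ) (X : (domSys (F.P K) M (k + 1)).Dom), DifferentiableOn ℂ (Φ K k X) (U K k X))
    (hΦemb : letI := θ.instVβ₁; letI := θ.instVβ₂
      ∀ (K k : ℕ) (X : (domSys (F.P K) M (k + 1)).Dom) (B : Fin (F.P K).d → Site (F.P K) (k + 1) → θ.Vβ),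
        Φ K k X (ι K k X B) = emb K k (fun l t => NormedSpace.exp (θ.ρ8 (B l t))))
    (hΦsp : ∀ (K k : ℕ) (X : (domSys (F.P K) M (k + 1)).Dom), ∀ z ∈ U K k X, ∀ Z : (domSys (F.P K) M (k + 1)).Dom, Z.1 ⊆ X.1 → Φ K k X z ∈ sp K k Z)
    (w : (K k : ℕ) → (domSys (F.P K) M (k + 1)).Dom → Site (F.P K) (k + 1) → ℝ) (hw₀ : ∀ K k X t, 0 ≤ w K k X t)
    (hw : letI := θ.instVβ₁; letI := θ.instVβ₂; letI := θ.instιβ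
      ∀ (K k : ℕ) (X : (domSys (F.P K) M (k + 1)).Dom) (l : Fin (F.P K).d) (t : Site (F.P K) (k + 1)) (c : θ.ιβ),
        ‖ι K k X (Pi.single l (Pi.single t (θ.bV c)))‖ ≤ w K k X t)
    (htail : ∀ (K k : ℕ) (X : (domSys (F.P K) M (k + 1)).Dom) (t : Site (F.P K) (k + 1)),
      let e : Site (F.P K) (k + 1) → TPt 4 (domCount (F.P K) M (k + 1) * M) := fun x i => (ZMod.cast (x i) : ZMod (domCount (F.P K) M (k + 1) * M))
      w K k X t ≤ B₃ * Real.exp (-δ₀ * distCT (domCount (F.P K) M (k + 1)) M (e t) (nearT (M := M) (e t) X)))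
    (hκ' : κ' ≤ delta1 δ₀ κ ((M : ℝ) * 4)) (μ ν : Fin 4) :
    KernelDecayOfRecord₁₃ F N θ μ ν κ' :=
  kernelDecayOfRecord₁₃_of_activitySlots F N θ hlim m' M hM S emb hloc Wk hWk sp hA hr₁ hκ hκ₀ hrate hsmall hδ₀ hB₃ hr h238 Ec ι Φ U hU hrU
    (fun g hg K k X => differentiableOn_H_comp_of_analyticH ((S K) k) (Wk K k) (sp K k) (hAn K k) (hWk g hg K k) (Φ K k X) (hΦhol K k X) X
      (hΦsp K k X))
    hΦemb hΦsp w hw₀ hw htail hκ' μ ν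

/-! ## §3 The PIN FACES for every run length: K3⁷ v5's N22 conjunct and the (D4) read-out at a reading pinned to the kernel objects of record -/

open Classical in
/-- ★★★ **THE N22 PIN FACE FROM W1's THREE SLOTS (PRINTED analyticity) + (1.21) EXISTENCE** — K3⁷ v5's N22 conjunct `N22At (rateCarriersOfRecord₁₃CoPH 𝔯 F θ hP g₀ os k).u3`
for EVERY `k`, at a Stage-13 rate reading `𝔯` whose node-U3 objects at the tuple ARE the kernel objects of record (`hpin`), for a letter block `ℓ` dominating the
engine's constants: `ne9_EA_objectsOfRecord₁₃_of_printedSlots` fed to dag-n22-w3's `n22At_rateCarriers_of_kernels_pin_of_ne9` (= K3⁷ v5 §2b `n22At_rrOfRecord_of_pinned` at the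
selector's value).  LOCATED (hypothesis form); N22 NOT discharged. -/
theorem n22At_rateCarriers_of_kernels_pin_of_printedSlots (𝔯 : RateReading₁₃CoPH N) (θ : Stage13HParams F N) (hP : θ.Provisos₁₃CoPH F N)
    (g₀ : ℕ → ℝ) (os : List (ULoop F)) (ℓ : U3Letters₁₁) (hs : ℓ.Signs) (hpin : (𝔯.lit F θ hP g₀ os).u3 = objectsOfRecord₁₃ F N θ.toStage13Params ℓ)
    (hlim : PolLimitsExistOfRecord₁₃ F N θ.toStage13Params) (m' : ℕ) (M : ℕ) [NeZero M] (hM : M = F.L ^ m')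
    (S : (K : ℕ) → ClusterTower (F.P K) (MatA N) M) (emb : ReadingMaps F (MatA N) (MatA N)) (hloc : Localizes17OfRecord₁₃ F N θ.toStage13Params S emb)
    (Wk : (K k : ℕ) → Set (Fin (k + 1) → ℝ)) (hWk : ∀ g ∈ Window θ.γ, ∀ K k, histPrefix g k ∈ Wk K k)
    (sp : (K k : ℕ) → (domSys (F.P K) M (k + 1)).Dom → Set (CPair (F.P K) (MatA N)))
    {A R r₁ κ δ₀ B₃ r : ℝ} (Λ : ℕ → ℕ → ℝ)
    (hA : 0 < A) (hr₁ : 0 ≤ r₁) (hκ : κ ≤ r₁) (hκ₀ : kappa₀ (4 * 2 ^ 4) (2 * 4) ≤ κ / 2) (hrate : r₁ + 2 * (64 * Real.log 162) + 2 ≤ R)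
    (hsmall : 2 * A * Real.exp (5 * r₁ + 1) * K₀ 64 8 * 9 * 64 ≤ 1) (hΛ : ∀ k i, 0 ≤ Λ k i) (hδ₀ : 0 < δ₀) (hB₃ : 0 ≤ B₃) (hr : 0 < r)
    (h238 : ∀ K k, ((S K) k).Bound238 (Wk K k) (sp K k) A R)
    (hYL : ∀ K k, ((S K) k).YoungLipschitz (Wk K k) (sp K k) (fun i : Fin (k + 1) => Λ (k + 1) i) R)
    (hAn : ∀ K k, ((S K) k).AnalyticH (Wk K k) (sp K k))
    (Ec : ℕ → ℕ → Type*) [∀ K k, NormedAddCommGroup (Ec K k)] [∀ K k, NormedSpace ℂ (Ec K k)]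
    (ι : letI := θ.instVβ₁; letI := θ.instVβ₂
      (K k : ℕ) → (domSys (F.P K) M (k + 1)).Dom → ((Fin (F.P K).d → Site (F.P K) (k + 1) → θ.Vβ) →L[ℝ] Ec K k))
    (Φ : (K k : ℕ) → (domSys (F.P K) M (k + 1)).Dom → Ec K k → CPair (F.P K) (MatA N))
    (U : (K k : ℕ) → (domSys (F.P K) M (k + 1)).Dom → Set (Ec K k)) (hU : ∀ K k X, IsOpen (U K k X)) (hrU : ∀ K k X, ball (0 : Ec K k) r ⊆ U K k X)
    (hΦhol : ∀ (K k : ℕ) (X : (domSys (F.P K) M (k + 1)).Dom), DifferentiableOn ℂ (Φ K k X) (U K k X))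
    (hΦemb : letI := θ.instVβ₁; letI := θ.instVβ₂
      ∀ (K k : ℕ) (X : (domSys (F.P K) M (k + 1)).Dom) (B : Fin (F.P K).d → Site (F.P K) (k + 1) → θ.Vβ),
        Φ K k X (ι K k X B) = emb K k (fun l t => NormedSpace.exp (θ.ρ8 (B l t))))
    (hΦsp : ∀ (K k : ℕ) (X : (domSys (F.P K) M (k + 1)).Dom), ∀ z ∈ U K k X, ∀ Z : (domSys (F.P K) M (k + 1)).Dom, Z.1 ⊆ X.1 → Φ K k X z ∈ sp K k Z)
    (w : (K k : ℕ) → (domSys (F.P K) M (k + 1)).Dom → Site (F.P K) (k + 1) → ℝ) (hw₀ : ∀ K k X t, 0 ≤ w K k X t)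
    (hw : letI := θ.instVβ₁; letI := θ.instVβ₂; letI := θ.instιβ
      ∀ (K k : ℕ) (X : (domSys (F.P K) M (k + 1)).Dom) (l : Fin (F.P K).d) (t : Site (F.P K) (k + 1)) (c : θ.ιβ),
        ‖ι K k X (Pi.single l (Pi.single t (θ.bV c)))‖ ≤ w K k X t)
    (htail : ∀ (K k : ℕ) (X : (domSys (F.P K) M (k + 1)).Dom) (t : Site (F.P K) (k + 1)),
      let e : Site (F.P K) (k + 1) → TPt 4 (domCount (F.P K) M (k + 1) * M) := fun x i => (ZMod.cast (x i) : ZMod (domCount (F.P K) M (k + 1) * M))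
      w K k X t ≤ B₃ * Real.exp (-δ₀ * distCT (domCount (F.P K) M (k + 1)) M (e t) (nearT (M := M) (e t) X)))
    (hℓκ : ℓ.κ ≤ delta1 δ₀ κ ((M : ℝ) * 4))
    (hdom : ∀ k i, (16 * (8 * (Real.exp 1 * 9 * 64 * K₀ 64 8 ^ 2)) * B₃ ^ 2 / r ^ 2) *
        Real.exp (delta1 δ₀ κ ((M : ℝ) * 4) * ((M : ℝ) * 4) * 3) * K₀ (4 * 2 ^ 4) (2 * 4) * K₁ 4 (δ₀ / 2) * Λ k i ≤ ℓ.moduli k i) (k : ℕ) :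
    N22At (rateCarriersOfRecord₁₃CoPH 𝔯 F θ hP g₀ os k).u3 :=
  n22At_rateCarriers_of_kernels_pin_of_ne9 𝔯 θ hP g₀ os ℓ hs hpin
    (ne9_EA_objectsOfRecord₁₃_of_printedSlots F N θ.toStage13Params ℓ hs hlim m' M hM S emb hloc Wk hWk sp Λ hA hr₁ hκ hκ₀ hrate hsmall hΛ hδ₀ hB₃ hr
      h238 hYL hAn Ec ι Φ U hU hrU hΦhol hΦemb hΦsp w hw₀ hw htail hℓκ hdom) k


open Classical in
/-- ★★★ **THE (D4) PIN FACE FROM `Bound238` + PRINTED `AnalyticH` + HOLOMORPHIC READINGS + TAILS + (1.21) EXISTENCE + THE LETTER ROWS** — the β-read-out binders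
`ReadOutAt (datumOfRecord₁₃CoPH F N θ hP) (rateCarriersOfRecord₁₃CoPH 𝔯 F θ hP g₀ os k).u3` at NODE 00's Stage-13 datum of record for EVERY run length `k`, at a reading pinned to the
kernel objects of record (`hpin`), for a letter block with `ℓ.Signs`, `0 < ℓ.κ ≤ δ₁` and `β′₅.₁₀(4,1,ℓ.κ) ≤ ℓ.cr`: §2's `kernelDecayOfRecord₁₃_of_printedSlots` at `(μ, ν) = (0, 1)`,
`κ′ := ℓ.κ`, fed to dag-n27-w1's `readOutAt_objectsOfRecord₁₃_coPH` (= K3⁷ v5 §2b `readOutAt_rrOfRecord_of_pinned` at the selector's value — (D4) REDUCED to print's (5.10) clause of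
record there; (5.10) is NOT discharged: its tree road has undischarged leaves).  LOCATED (hypothesis form); (D4) NOT discharged. -/
theorem readOutAt_rateCarriers_of_kernels_pin_of_printedSlots (𝔯 : RateReading₁₃CoPH N) (θ : Stage13HParams F N) (hP : θ.Provisos₁₃CoPH F N)
    (g₀ : ℕ → ℝ) (os : List (ULoop F)) (ℓ : U3Letters₁₁) (hs : ℓ.Signs) (hℓ₀ : 0 < ℓ.κ) (hcr : betaPrime510 4 1 ℓ.κ ≤ ℓ.cr)
    (hpin : (𝔯.lit F θ hP g₀ os).u3 = objectsOfRecord₁₃ F N θ.toStage13Params ℓ)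
    (hlim : PolLimitsExistOfRecord₁₃ F N θ.toStage13Params) (m' : ℕ) (M : ℕ) [NeZero M] (hM : M = F.L ^ m')
    (S : (K : ℕ) → ClusterTower (F.P K) (MatA N) M) (emb : ReadingMaps F (MatA N) (MatA N)) (hloc : Localizes17OfRecord₁₃ F N θ.toStage13Params S emb)
    (Wk : (K k : ℕ) → Set (Fin (k + 1) → ℝ)) (hWk : ∀ g ∈ Window θ.γ, ∀ K k, histPrefix g k ∈ Wk K k)
    (sp : (K k : ℕ) → (domSys (F.P K) M (k + 1)).Dom → Set (CPair (F.P K) (MatA N)))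
    {A R r₁ κ δ₀ B₃ r : ℝ}
    (hA : 0 ≤ A) (hr₁ : 0 ≤ r₁) (hκ : κ ≤ r₁) (hκ₀ : kappa₀ (4 * 2 ^ 4) (2 * 4) ≤ κ / 2) (hrate : r₁ + 2 * (64 * Real.log 162) + 2 ≤ R)
    (hsmall : A * Real.exp (5 * r₁ + 1) * K₀ 64 8 * 9 * 64 ≤ 1) (hδ₀ : 0 < δ₀) (hB₃ : 0 ≤ B₃) (hr : 0 < r)
    (h238 : ∀ K k, ((S K) k).Bound238 (Wk K k) (sp K k) A R)
    (hAn : ∀ K k, ((S K) k).AnalyticH (Wk K k) (sp K k))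
    (Ec : ℕ → ℕ → Type*) [∀ K k, NormedAddCommGroup (Ec K k)] [∀ K k, NormedSpace ℂ (Ec K k)]
    (ι : letI := θ.instVβ₁; letI := θ.instVβ₂
      (K k : ℕ) → (domSys (F.P K) M (k + 1)).Dom → ((Fin (F.P K).d → Site (F.P K) (k + 1) → θ.Vβ) →L[ℝ] Ec K k))
    (Φ : (K k : ℕ) → (domSys (F.P K) M (k + 1)).Dom → Ec K k → CPair (F.P K) (MatA N))
    (U : (K k : ℕ) → (domSys (F.P K) M (k + 1)).Dom → Set (Ec K k)) (hU : ∀ K k X, IsOpen (U K k X)) (hrU : ∀ K k X, ball (0 : Ec K k) r ⊆ U K k X)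
    (hΦhol : ∀ (K k : ℕ) (X : (domSys (F.P K) M (k + 1)).Dom), DifferentiableOn ℂ (Φ K k X) (U K k X))
    (hΦemb : letI := θ.instVβ₁; letI := θ.instVβ₂
      ∀ (K k : ℕ) (X : (domSys (F.P K) M (k + 1)).Dom) (B : Fin (F.P K).d → Site (F.P K) (k + 1) → θ.Vβ),
        Φ K k X (ι K k X B) = emb K k (fun l t => NormedSpace.exp (θ.ρ8 (B l t))))
    (hΦsp : ∀ (K k : ℕ) (X : (domSys (F.P K) M (k + 1)).Dom), ∀ z ∈ U K k X, ∀ Z : (domSys (F.P K) M (k + 1)).Dom, Z.1 ⊆ X.1 → Φ K k X z ∈ sp K k Z)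
    (w : (K k : ℕ) → (domSys (F.P K) M (k + 1)).Dom → Site (F.P K) (k + 1) → ℝ) (hw₀ : ∀ K k X t, 0 ≤ w K k X t)
    (hw : letI := θ.instVβ₁; letI := θ.instVβ₂; letI := θ.instιβ
      ∀ (K k : ℕ) (X : (domSys (F.P K) M (k + 1)).Dom) (l : Fin (F.P K).d) (t : Site (F.P K) (k + 1)) (c : θ.ιβ),
        ‖ι K k X (Pi.single l (Pi.single t (θ.bV c)))‖ ≤ w K k X t)
    (htail : ∀ (K k : ℕ) (X : (domSys (F.P K) M (k + 1)).Dom) (t : Site (F.P K) (k + 1)),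
      let e : Site (F.P K) (k + 1) → TPt 4 (domCount (F.P K) M (k + 1) * M) := fun x i => (ZMod.cast (x i) : ZMod (domCount (F.P K) M (k + 1) * M))
      w K k X t ≤ B₃ * Real.exp (-δ₀ * distCT (domCount (F.P K) M (k + 1)) M (e t) (nearT (M := M) (e t) X)))
    (hℓκ : ℓ.κ ≤ delta1 δ₀ κ ((M : ℝ) * 4)) (k : ℕ) :
    ReadOutAt (datumOfRecord₁₃CoPH F N θ hP) (rateCarriersOfRecord₁₃CoPH 𝔯 F θ hP g₀ os k).u3 := by
  show ReadOutAt (datumOfRecord₁₃CoPH F N θ hP) (u3OfRecord₁₃ θ.toStage13Params (𝔯.lit F θ hP g₀ os).u3 k)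
  rw [hpin]
  exact readOutAt_objectsOfRecord₁₃_coPH θ hP ℓ hs hℓ₀ hcr k
    (kernelDecayOfRecord₁₃_of_printedSlots F N θ.toStage13Params hlim m' M hM S emb hloc Wk hWk sp hA hr₁ hκ hκ₀ hrate hsmall hδ₀ hB₃ hr h238 hAn
      Ec ι Φ U hU hrU hΦhol hΦemb hΦsp w hw₀ hw htail hℓκ 0 1)

/-! ## §4 A5∕A6 rider: the termless model step carries `AnalyticH` (non-vacuity of the PRINTED slot at the degenerate witness) -/

/-- **NON-VACUITY (A5 rider).**  The termless MODEL step (`idx Z = ∅`, so `H ≡ 0`) carries W1's PRINTED slot `AnalyticH` on any tables — the activity is the empty sum,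
a constant; with J31 `coordHolo_termlessStep` (margin datum) and dag-n22-w2's `…AtSlotsInhabited` (readings∕weights∕numerals at the empty towers) the non-record
hypotheses of §1–§3 are jointly inhabited at the EMPTY towers — a DEGENERATE model witness, declared; the towers, reading and law OF RECORD are NOT these. -/
theorem analyticH_termlessStep {P : Params} {𝔸 : Type*} [NormedRing 𝔸] [NormedAlgebra ℂ 𝔸] {M k : ℕ} (Wk : Set (Fin (k + 1) → ℝ))
    (sp : (domSys P M (k + 1)).Dom → Set (CPair P 𝔸)) :
    (⟨PUnit, fun _ => ∅, fun _ _ _ => 0⟩ : ClusterStep P 𝔸 M k).AnalyticH Wk sp := by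
  intro g _ Z
  have h0 : (fun φ : CPair P 𝔸 => (⟨PUnit, fun _ => ∅, fun _ _ _ => 0⟩ : ClusterStep P 𝔸 M k).H g φ Z) = fun _ => 0 := by
    funext φ
    simp [ClusterStep.H]
  rw [h0]
  exact analyticOnNhd_const

end YMDAG.N22.AtRecordOfPrintedSlots

end
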